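import Mathlib
import HarnessLib
import Literature.Analysis.FluidPDE.NSBoundedMildSmoothing
import Literature.Analysis.FluidPDE.KNSSLocalSmoothingHolds
import Literature.Analysis.FluidPDE.SpaceTimeCalculus
import Literature.Analysis.FluidPDE.TypeIAncientMildClassical
import Summits.NavierStokesRegularity.NavierStokesRegularity.Theorems.LocalSineTubeDoorProfileAlignedWindowRigidityAncient
import Summits.NavierStokesRegularity.NavierStokesRegularity.Theorems.PoloidalWindowDoorPoloidalWindowRigidityWindow
import Summits.NavierStokesRegularity.NavierStokesRegularity.Theorems.PoloidalWindowDoorPoloidalWindowRigidityClassRate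
import Summits.NavierStokesRegularity.NavierStokesRegularity.Theorems.PoloidalWindowDoorPoloidalWindowRigidityVelocityGradientLaw
import Summits.NavierStokesRegularity.NavierStokesRegularity.Theorems.PoloidalWindowDoorPoloidalWindowRigiditySeparatedPressure
import Summits.NavierStokesRegularity.NavierStokesRegularity.Theorems.PoloidalWindowDoorPoloidalWindowRigidityVerticalSourceGauge
import Summits.NavierStokesRegularity.NavierStokesRegularity.Theorems.PoloidalWindowDoorPoloidalWindowRigidityConstantShearMeans

/-!
# Route `PoloidalWindowDoor`, crux `PoloidalWindowRigidity` (K2, stmt-NavierStokesRegularity-19708) —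
# the CONSTANT-SHEAR («wave») stratum: the pointwise inputs from the profile class

Cell ns-regularity-ideate, seat ns-poloidal-K2-p2 (stub-worker, gen 2; support lemmas `--supports` the crux,
`--as helper`).  Third brick of the (M)-consuming exclusion of `∂₂v_h ≡ μ∇_h v₂` (`μ < 1` constant).  For a profile
`v` of the route's Type-I class (rate `C`, continuous, unit-viscosity Oseen-mild, divergence-free) this file supplies,
slice by slice, the hypotheses of the averaged identities of `…ConstantShearMeans` / `…ConstantShearEnergy`:

* `exists_timeDeriv_rate_of_class` — the SCALE-SHARP TIME-DERIVATIVE RATE `‖∂ₜv(t,x)‖ ≤ C₄/((−t)√(−t))`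
  (KNSS 2009 Prop. 4.1 with `k = 0, l = 1` and its uniform constants, restarted at the datum time `(1+δ)t`;
  verbatim the route of `…ClassRate.exists_fderiv_rate_of_class`);
* `div_coord`, `wave_identity` — `∂₀v₀ + ∂₁v₁ + ∂₂v₂ = 0` in coordinates, and, for a `C²` divergence-free field with
  `∂₂u_b = μ∂_bu₂` (`b = 0,1`), the slice WAVE IDENTITY `∂₂²u₂ = −μ(∂₀²u₂ + ∂₁²u₂)`;
* `laplacian_eq_sum_fderiv_fderiv`, `vertical_equation_coord` — the vertical momentum equation of the class in
  coordinates: `∂ₜv₂ + Dv₂(v) − Σᵢ∂ᵢ∂ᵢv₂ = f₂`, `f = ∂ₜv + (v·∇)v − Δv` the intrinsic residual (K2-p3's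
  `…VerticalSourceGauge.vertical_equation`);
* `residual_vert_eq_of_height_eq` — on the stratum (`μ ≠ 1`, all slices), `f₂(t,x)` depends on `x₂` only (K2-p3's
  `separatedPressure_of_clebschSlope` gives `∇_h f₂ ≡ 0`; integrate along horizontal segments);
* `contDiff_timeDeriv_slice`, `div_timeDeriv_slice` — the slice `∂ₜv(t,·)` is smooth and divergence-free.

WHAT THIS IS NOT: not a claim about Navier–Stokes regularity and not the open residue S2⁗ — class bookkeeping for one
located stratum of a door route's Type-I Liouville problem (bears_on LADDER-NS N0, rung N0-LocalTubeDoorPoloidal).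
-/

noncomputable section

-- the summit and its single sub-problem share the name (CONVENTIONS §1), as in every Theorems file
set_option linter.dupNamespace false

namespace Summit.NavierStokesRegularity.NavierStokesRegularity.Theorems.PoloidalWindowDoorPoloidalWindowRigidityConstantShearSlice

open MeasureTheory Set Function Filter Topology Metric InnerProductSpace
open scoped RealInnerProductSpace InnerProductSpace Laplacian ContDiff ENNReal
open Literature.Analysis Literature.Analysis.FluidPDE
open Summit.NavierStokesRegularity.NavierStokesRegularity.Theorems.LocalSineTubeDoorProfileAlignedWindowRigidityAncient
open Summit.NavierStokesRegularity.NavierStokesRegularity.Theorems.PoloidalWindowDoorPoloidalWindowRigidityWindow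
open Summit.NavierStokesRegularity.NavierStokesRegularity.Theorems.PoloidalWindowDoorPoloidalWindowRigidityVelocityGradientLaw
open Summit.NavierStokesRegularity.NavierStokesRegularity.Theorems.PoloidalWindowDoorPoloidalWindowRigiditySeparatedPressure
open Summit.NavierStokesRegularity.NavierStokesRegularity.Theorems.PoloidalWindowDoorPoloidalWindowRigidityVerticalSourceGauge
open Summit.NavierStokesRegularity.NavierStokesRegularity.Theorems.PoloidalWindowDoorPoloidalWindowRigidityConstantShearMeans

variable {C : ℝ} {v : ℝ → EuclideanSpace ℝ (Fin 3) → EuclideanSpace ℝ (Fin 3)}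

/-! ### The scale-sharp time-derivative rate of the class -/

/-- **TIME-DERIVATIVE RATE ON THE CLASS**: one constant `C₄` with `‖∂ₜv(t,y)‖ ≤ C₄/((−t)√(−t))` for every `t < 0`
and `y` (KNSS 2009 Prop. 4.1, `k = 0`, `l = 1`, uniform constants; restart at the datum time `s' = (1+δ)t`,
`δ = ε/(4C'²)`, on whose window the smooth local representative IS `v` and obeys `(t−s')‖∂ₜw‖ ≤ C_L M`). -/
theorem exists_timeDeriv_rate_of_class (hrate : HasTypeITimeDecay C v)
    (hcont : ContinuousOn (uncurry v) (Iio (0 : ℝ) ×ˢ univ))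
    (hmild : ∀ s t : ℝ, s < t → t < 0 → ∀ y,
      v t y = UnboundedOperators.heatExtension (v s) (t - s) y - oseenDuhamel 1 s v v t y) :
    ∃ C₄ : ℝ, ∀ t < 0, ∀ y, ‖deriv (fun τ => v τ y) t‖ ≤ C₄ / ((-t) * Real.sqrt (-t)) := by
  obtain ⟨ε, hε, CL, hCL, hL⟩ := knss2009_local_smoothing_holds (EuclideanSpace ℝ (Fin 3)) 0 1
  set C' : ℝ := max C 1 with hC'
  have hC'1 : 1 ≤ C' := le_max_right _ _
  have hC'0 : 0 < C' := lt_of_lt_of_le one_pos hC'1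
  have hCC' : C ≤ C' := le_max_left _ _
  set δ : ℝ := ε / (4 * C' ^ 2) with hδ
  have hδ0 : 0 < δ := div_pos hε (by positivity)
  refine ⟨CL * C' * Real.sqrt 2 / δ, fun t ht y => ?_⟩
  have hnt : 0 < -t := neg_pos.2 ht
  set s' : ℝ := t - δ * (-t) with hs'
  have hs't : s' < t := by rw [hs']; nlinarith
  have hs'0 : s' < 0 := hs't.trans ht
  have hT : s' < t / 2 := by linarith
  set M : ℝ := C' * Real.sqrt 2 / Real.sqrt (-t) with hM
  have hsq0 : 0 < Real.sqrt (-t) := Real.sqrt_pos.2 hnt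
  have hM0 : 0 < M := div_pos (mul_pos hC'0 (Real.sqrt_pos.2 two_pos)) hsq0
  have hbound : ∀ τ < t / 2, ∀ x, ‖v τ x‖ ≤ M := by
    intro τ hτ x
    have hτ0 : τ < 0 := by linarith
    refine (hrate τ hτ0 x).trans ?_
    have h1 : C / Real.sqrt (-τ) ≤ C' / Real.sqrt (-τ) :=
      div_le_div_of_nonneg_right hCC' (Real.sqrt_nonneg _)
    refine h1.trans ?_
    rw [hM, div_le_div_iff₀ (Real.sqrt_pos.2 (by linarith)) hsq0]
    have h2 : Real.sqrt (-t) ≤ Real.sqrt 2 * Real.sqrt (-τ) := by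
      rw [← Real.sqrt_mul (by norm_num : (0:ℝ) ≤ 2)]
      exact Real.sqrt_le_sqrt (by linarith)
    calc C' * Real.sqrt (-t) ≤ C' * (Real.sqrt 2 * Real.sqrt (-τ)) :=
          mul_le_mul_of_nonneg_left h2 hC'0.le
      _ = C' * Real.sqrt 2 * Real.sqrt (-τ) := by ring
  have ha : AEStronglyMeasurable (v s') volume := (continuous_slice hcont hs'0).aestronglyMeasurable
  have haM : eLpNorm (v s') ∞ volume ≤ ENNReal.ofReal M := by
    rw [eLpNorm_exponent_top]
    exact eLpNormEssSup_le_of_ae_bound (Eventually.of_forall fun x => hbound _ (by linarith) x)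
  have hsub : Ioo s' (t / 2) ×ˢ (univ : Set (EuclideanSpace ℝ (Fin 3))) ⊆ Iio 0 ×ˢ univ :=
    prod_mono (fun τ hτ => lt_trans hτ.2 (by linarith)) subset_rfl
  have hu : AEStronglyMeasurable (uncurry v) (volume.restrict (Ioo s' (t / 2) ×ˢ univ)) :=
    (hcont.mono hsub).aestronglyMeasurable (measurableSet_Ioo.prod MeasurableSet.univ)
  have hub : ∀ τ ∈ Ioo s' (t / 2), eLpNorm (v τ) ∞ volume ≤ ENNReal.ofReal M := by
    intro τ hτ
    rw [eLpNorm_exponent_top]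
    exact eLpNormEssSup_le_of_ae_bound (Eventually.of_forall fun x => hbound τ hτ.2 x)
  have hmild' : ∀ τ ∈ Ioo s' (t / 2), v τ =ᵐ[volume] fun x =>
      UnboundedOperators.heatExtension (v s') (1 * (τ - s')) x - oseenDuhamel 1 s' v v τ x := fun τ hτ =>
    Eventually.of_forall fun x => by
      rw [one_mul]; exact hmild s' τ hτ.1 (by linarith [hτ.2]) x
  obtain ⟨w, -, -, hrep, -, hbd⟩ :=
    exists_local_smooth_representative hL one_pos hM0 hCL ha haM hu hub hmild'
  have hM2 : M ^ 2 = 2 * C' ^ 2 / (-t) := by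
    rw [hM, div_pow, mul_pow, Real.sq_sqrt (by norm_num : (0:ℝ) ≤ 2), Real.sq_sqrt hnt.le]
    ring
  have hq : ε * 1 / M ^ 2 = ε * (-t) / (2 * C' ^ 2) := by
    rw [hM2]
    field_simp
  have hδlt : δ * (-t) < ε * (-t) / (2 * C' ^ 2) := by
    rw [hδ, lt_div_iff₀ (by positivity)]
    have h1 : ε / (4 * C' ^ 2) * -t * (2 * C' ^ 2) = ε * -t / 2 := by
      field_simp
      ring
    rw [h1]
    linarith [mul_pos hε hnt]
  have hwin : t < s' + ε * 1 / M ^ 2 := by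
    rw [hq, hs']
    linarith
  have htmem' : t ∈ Ioo s' (s' + ε * 1 / M ^ 2) := ⟨hs't, hwin⟩
  -- the representative IS `v` on the open window `(s', min (s' + ε/M²) (t/2))` containing `t`
  have hwindow : ∀ τ ∈ Ioo s' (min (s' + ε * 1 / M ^ 2) (t / 2)), v τ y = w τ y := by
    intro τ hτ
    rw [← hrep τ hτ y, one_mul]
    exact hmild s' τ hτ.1 (by linarith [lt_min_iff.1 hτ.2]) y
  have hev : (fun τ => v τ y) =ᶠ[𝓝 t] fun τ => w τ y := by
    have hmem : Ioo s' (min (s' + ε * 1 / M ^ 2) (t / 2)) ∈ 𝓝 t :=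
      Ioo_mem_nhds hs't (lt_min hwin (by linarith))
    filter_upwards [hmem] with τ hτ using hwindow τ hτ
  -- the time-derivative bound of the local solution at time `t`
  have h := hbd t htmem' y
  have hrp : (1 * (t - s')) ^ ((0 : ℕ) / 2 : ℝ) = 1 := by
    rw [Nat.cast_zero, zero_div, Real.rpow_zero]
  rw [hrp, one_mul, pow_one, norm_iteratedFDeriv_zero, iteratedDeriv_one, ← hev.deriv_eq] at h
  have hts : t - s' = δ * (-t) := by rw [hs']; ring
  rw [hts] at h
  -- `δ(−t)‖∂ₜv‖ ≤ CL M = CL C' √2/√(−t)`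
  have hpos : 0 < δ * (-t) := mul_pos hδ0 hnt
  have h2 : ‖deriv (fun τ => v τ y) t‖ ≤ CL * M / (δ * (-t)) := by
    rw [le_div_iff₀ hpos]; linarith
  refine h2.trans (le_of_eq ?_)
  rw [hM]
  field_simp

/-! ### Slice kinematics in coordinates -/

/-- `div u = 0` in coordinates: `∂₀u₀ + ∂₁u₁ + ∂₂u₂ = 0`. -/
theorem div_coord {u : EuclideanSpace ℝ (Fin 3) → EuclideanSpace ℝ (Fin 3)} (hdiv : VectorCalculus.IsDivFree u)
    (x : EuclideanSpace ℝ (Fin 3)) :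
    fderiv ℝ u x (EuclideanSpace.single 0 (1 : ℝ)) 0 + fderiv ℝ u x (EuclideanSpace.single 1 (1 : ℝ)) 1 +
      fderiv ℝ u x (EuclideanSpace.single 2 (1 : ℝ)) 2 = 0 := by
  have hd := hdiv x
  rw [divergence_eq_sum_inner_fderiv (EuclideanSpace.basisFun (Fin 3) ℝ)] at hd
  simpa only [Fin.sum_univ_three, EuclideanSpace.basisFun_apply, EuclideanSpace.inner_single_left,
    map_one, one_mul] using hd

/-- **The slice WAVE IDENTITY.**  For a `C²` divergence-free field with proportional vertical shear
`∂₂u_b = μ ∂_bu₂` (`b = 0,1`): `∂₂²u₂ = ∂₂(−∂₀u₀ − ∂₁u₁) = −∂₀(∂₂u₀) − ∂₁(∂₂u₁) = −μ(∂₀²u₂ + ∂₁²u₂)`. -/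
theorem wave_identity {u : EuclideanSpace ℝ (Fin 3) → EuclideanSpace ℝ (Fin 3)} {μ : ℝ} (hu : ContDiff ℝ 2 u)
    (hdiv : ∀ x, fderiv ℝ u x (EuclideanSpace.single 0 (1 : ℝ)) 0 + fderiv ℝ u x (EuclideanSpace.single 1 (1 : ℝ)) 1 +
      fderiv ℝ u x (EuclideanSpace.single 2 (1 : ℝ)) 2 = 0)
    (hslope : ∀ y, ∀ b : Fin 3, b ≠ 2 →
      fderiv ℝ u y (EuclideanSpace.single 2 (1 : ℝ)) b = μ * fderiv ℝ u y (EuclideanSpace.single b (1 : ℝ)) 2)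
    (x : EuclideanSpace ℝ (Fin 3)) :
    fderiv ℝ (fun y => fderiv ℝ (fun y' => u y' 2) y (EuclideanSpace.single 2 (1 : ℝ))) x
        (EuclideanSpace.single 2 (1 : ℝ)) =
      -μ * (fderiv ℝ (fun y => fderiv ℝ (fun y' => u y' 2) y (EuclideanSpace.single 0 (1 : ℝ))) x
          (EuclideanSpace.single 0 (1 : ℝ)) +
        fderiv ℝ (fun y => fderiv ℝ (fun y' => u y' 2) y (EuclideanSpace.single 1 (1 : ℝ))) x
          (EuclideanSpace.single 1 (1 : ℝ))) := by
  have hud : Differentiable ℝ u := hu.differentiable (by norm_num)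
  have hc : ∀ i : Fin 3, ContDiff ℝ 2 (fun y => u y i) := fun i => contDiff_coord hu i
  -- `∂₂u₂ = −(∂₀u₀ + ∂₁u₁)` as functions, written through the coordinate scalars
  have hF : (fun y => fderiv ℝ (fun y' => u y' 2) y (EuclideanSpace.single 2 (1 : ℝ))) = fun y =>
      -(fderiv ℝ (fun y' => u y' 0) y (EuclideanSpace.single 0 (1 : ℝ)) +
        fderiv ℝ (fun y' => u y' 1) y (EuclideanSpace.single 1 (1 : ℝ))) := by
    funext y
    rw [fderiv_coord_apply (hud y) 2, fderiv_coord_apply (hud y) 0, fderiv_coord_apply (hud y) 1]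
    linarith [hdiv y]
  -- `∂₂u_b = μ ∂_b u₂` as functions (`b = 0,1`)
  have hS : ∀ b : Fin 3, b ≠ 2 → (fun y => fderiv ℝ (fun y' => u y' b) y (EuclideanSpace.single 2 (1 : ℝ))) =
      fun y => μ * fderiv ℝ (fun y' => u y' 2) y (EuclideanSpace.single b (1 : ℝ)) := by
    intro b hb
    funext y
    rw [fderiv_coord_apply (hud y) b, fderiv_coord_apply (hud y) 2, hslope y b hb]
  have hd1 : ∀ (i : Fin 3) (a : EuclideanSpace ℝ (Fin 3)) (y : EuclideanSpace ℝ (Fin 3)),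
      DifferentiableAt ℝ (fun y' => fderiv ℝ (fun y'' => u y'' i) y' a) y := fun i a y =>
    ((((hc i).fderiv_right (m := 1) (by norm_num)).clm_apply contDiff_const).differentiable one_ne_zero) y
  rw [hF, fderiv_fun_neg, neg_apply, fderiv_fun_add (hd1 0 _ x) (hd1 1 _ x)]
  simp only [_root_.add_apply]
  -- swap `∂₂∂_b u_b = ∂_b ∂₂ u_b`, insert the shear relation, differentiate `μ ∂_b u₂`
  rw [fderiv_fderiv_symm (hc 0), fderiv_fderiv_symm (hc 1), hS 0 (by decide), hS 1 (by decide),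
    fderiv_const_mul (hd1 2 _ x), fderiv_const_mul (hd1 2 _ x)]
  simp only [FunLike.coe_smul, Pi.smul_apply, smul_eq_mul]
  ring

/-- The Laplacian of a `C²` real function on `ℝ³` in coordinates: `Δg = Σᵢ ∂ᵢ∂ᵢg`. -/
theorem laplacian_eq_sum_fderiv_fderiv {g : EuclideanSpace ℝ (Fin 3) → ℝ} (hg : ContDiff ℝ 2 g)
    (x : EuclideanSpace ℝ (Fin 3)) :
    Δ g x = ∑ i : Fin 3, fderiv ℝ (fun y => fderiv ℝ g y (EuclideanSpace.single i (1 : ℝ))) x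
      (EuclideanSpace.single i (1 : ℝ)) := by
  rw [InnerProductSpace.laplacian_eq_iteratedFDeriv_orthonormalBasis g (EuclideanSpace.basisFun (Fin 3) ℝ)]
  refine Finset.sum_congr rfl fun i _ => ?_
  rw [iteratedFDeriv_two_apply, fderiv_clm_apply]
  · simp [EuclideanSpace.basisFun_apply]
  · exact ((hg.fderiv_right (m := 1) (by norm_num)).differentiable one_ne_zero) x
  · exact differentiableAt_const _

/-- **The vertical momentum equation of the class in coordinates**: for `t < 0` and every `x`,
`∂ₜv₂ + Dv₂(v) − Σᵢ∂ᵢ∂ᵢv₂ = f₂` with `f = ∂ₜv + (v·∇)v − Δv` the intrinsic residual. -/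
theorem vertical_equation_coord (hrate : HasTypeITimeDecay C v)
    (hcont : ContinuousOn (uncurry v) (Iio (0 : ℝ) ×ˢ univ))
    (hmild : ∀ s t : ℝ, s < t → t < 0 → ∀ x,
      v t x = UnboundedOperators.heatExtension (v s) (t - s) x - oseenDuhamel 1 s v v t x)
    (hdiv : ∀ t < 0, VectorCalculus.IsDivFree (v t)) {t : ℝ} (ht : t < 0) (x : EuclideanSpace ℝ (Fin 3)) :
    deriv (fun τ => v τ x 2) t + fderiv ℝ (fun y => v t y 2) x (v t x) -
        ∑ i : Fin 3, fderiv ℝ (fun y => fderiv ℝ (fun y' => v t y' 2) y (EuclideanSpace.single i (1 : ℝ))) x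
          (EuclideanSpace.single i (1 : ℝ)) =
      (timeDerivWithin (Iio 0) v t x + convect (v t) (v t) x - Δ (v t) x) 2 := by
  have hA : IsTypeIAncientMild C v := isTypeIAncientMild_of_class hrate hcont hmild hdiv
  have h2 : ContDiff ℝ 2 (fun y => v t y 2) := contDiff_coord ((hA.contDiff_slice ht).of_le (by norm_cast)) 2
  have hv := vertical_equation hrate hcont hmild hdiv ht x
  have hfun : (fun y => ⟪v t y, (EuclideanSpace.single 2 (1 : ℝ) : EuclideanSpace ℝ (Fin 3))⟫_ℝ) = fun y => v t y 2 := by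
    funext y; simp [EuclideanSpace.inner_single_right]
  have hfun' : (fun τ => ⟪v τ x, (EuclideanSpace.single 2 (1 : ℝ) : EuclideanSpace ℝ (Fin 3))⟫_ℝ) = fun τ => v τ x 2 := by
    funext τ; simp [EuclideanSpace.inner_single_right]
  rw [hfun, hfun', laplacian_eq_sum_fderiv_fderiv h2] at hv
  rw [hv]
  simp [EuclideanSpace.inner_single_right]

/-! ### On the stratum the vertical residual depends on the height only -/

/-- **`f₂(t,·)` is a function of `x₂` alone on the constant-shear stratum** (`μ ≠ 1`): K2-p3's
`separatedPressure_of_clebschSlope` gives `∂₀f₂ = ∂₁f₂ = 0`; since `f(t,·) = −∇p(t,·)` is smooth (classical pressure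
of the window `(2t,0)`), `f₂` is constant along every horizontal segment. -/
theorem residual_vert_eq_of_height_eq (hrate : HasTypeITimeDecay C v)
    (hcont : ContinuousOn (uncurry v) (Iio (0 : ℝ) ×ˢ univ))
    (hmild : ∀ s t : ℝ, s < t → t < 0 → ∀ x,
      v t x = UnboundedOperators.heatExtension (v s) (t - s) x - oseenDuhamel 1 s v v t x)
    (hdiv : ∀ t < 0, VectorCalculus.IsDivFree (v t))
    (hpol : ∀ s < 0, ∀ y, ⟪curl (v s) y, EuclideanSpace.single 2 1⟫_ℝ = 0) {μ : ℝ} (hμ : μ ≠ 1)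
    (hslope : ∀ s < 0, ∀ y, ∀ b : Fin 3, b ≠ 2 →
      fderiv ℝ (v s) y (EuclideanSpace.single 2 1) b = μ * fderiv ℝ (v s) y (EuclideanSpace.single b 1) 2)
    {t : ℝ} (ht : t < 0) {x x' : EuclideanSpace ℝ (Fin 3)} (hxx' : x 2 = x' 2) :
    (timeDerivWithin (Iio 0) v t x + convect (v t) (v t) x - Δ (v t) x) 2 =
      (timeDerivWithin (Iio 0) v t x' + convect (v t) (v t) x' - Δ (v t) x') 2 := by
  have hA : IsTypeIAncientMild C v := isTypeIAncientMild_of_class hrate hcont hmild hdiv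
  have h2t : 2 * t < 0 := by linarith
  have htS : t ∈ Ioo (2 * t) 0 := ⟨by linarith, ht⟩
  obtain ⟨p, hns⟩ := hA.exists_isClassicalNSSolutionOn_Ioo h2t
  -- the residual on the window is `−∇p`, a smooth field
  set f : EuclideanSpace ℝ (Fin 3) → EuclideanSpace ℝ (Fin 3) :=
    fun y => timeDerivWithin (Iio 0) v t y + convect (v t) (v t) y - Δ (v t) y with hf
  have hres : f = fun y => -gradient (p t) y := by
    funext y
    have hm := hns.momentum t htS y
    have hTD : timeDerivWithin (Ioo (2 * t) 0) v t y = timeDerivWithin (Iio 0) v t y := by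
      rw [timeDerivWithin_eq_deriv_of_isOpen_subset isOpen_Ioo subset_rfl htS v,
        timeDerivWithin_eq_deriv_of_isOpen_subset isOpen_Iio subset_rfl ht v]
    simp only [hTD, one_smul, Pi.zero_apply, add_zero] at hm
    simp only [hf, hm]
    abel
  have hp : ContDiff ℝ ∞ (p t) := hns.contDiff_pressure htS
  have hfd : Differentiable ℝ f := by
    rw [hres]
    have hg : Differentiable ℝ (gradient (p t)) := by
      have h1 : ContDiff ℝ 1 (fderiv ℝ (p t)) := hp.fderiv_right (m := 1) (by norm_cast)
      have h2 : gradient (p t) = fun y => (InnerProductSpace.toDual ℝ (EuclideanSpace ℝ (Fin 3))).symm (fderiv ℝ (p t) y) := by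
        funext y; rfl
      rw [h2]
      exact (InnerProductSpace.toDual ℝ (EuclideanSpace ℝ (Fin 3))).symm.differentiable.comp
        (h1.differentiable one_ne_zero)
    exact hg.neg
  -- the scalar `F = f₂` has vanishing horizontal partial derivatives
  set F : EuclideanSpace ℝ (Fin 3) → ℝ := fun y => f y 2 with hF
  have hFd : Differentiable ℝ F := fun y => by
    have h := ((EuclideanSpace.proj (𝕜 := ℝ) (2 : Fin 3)).hasFDerivAt).comp y (hfd y).hasFDerivAt
    exact h.differentiableAt
  have hF0 : ∀ y, fderiv ℝ F y (EuclideanSpace.single 0 (1 : ℝ)) = 0 := fun y => by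
    rw [hF, fderiv_coord_apply (hfd y) 2]
    exact (separatedPressure_of_clebschSlope hrate hcont hmild hdiv hpol hμ hslope ht y (b := 0) (by decide)).1
  have hF1 : ∀ y, fderiv ℝ F y (EuclideanSpace.single 1 (1 : ℝ)) = 0 := fun y => by
    rw [hF, fderiv_coord_apply (hfd y) 2]
    exact (separatedPressure_of_clebschSlope hrate hcont hmild hdiv hpol hμ hslope ht y (b := 1) (by decide)).1
  -- integrate along the horizontal segment from `x` to `x'`
  set d : EuclideanSpace ℝ (Fin 3) := x' - x with hd
  have hd2 : d 2 = 0 := by rw [hd]; simp [hxx']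
  set γ : ℝ → ℝ := fun s => F (x + s • d) with hγ
  have hγd : ∀ s, HasDerivAt γ 0 s := by
    intro s
    have hline : HasDerivAt (fun s : ℝ => x + s • d) d s := by
      simpa using ((hasDerivAt_id s).smul_const d).const_add x
    have h := (hFd (x + s • d)).hasFDerivAt.comp_hasDerivAt s hline
    have hzero : fderiv ℝ F (x + s • d) d = 0 := by
      rw [fderiv_apply_eq_sum]
      simp only [Fin.sum_univ_three, hF0, hF1, hd2, mul_zero, zero_mul, add_zero]
    rw [hzero] at h
    exact h
  have hconst := is_const_of_deriv_eq_zero (fun s => (hγd s).differentiableAt) (fun s => (hγd s).deriv) 0 1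
  simp only [hγ, zero_smul, add_zero, one_smul] at hconst
  have hx' : x + d = x' := by rw [hd]; abel
  rw [hx'] at hconst
  exact hconst

/-! ### The time-derivative slice is smooth and divergence-free -/

/-- The slice `x ↦ ∂ₜv(t,x)` of a profile of the class is `C^∞`. -/
theorem contDiff_timeDeriv_slice (hrate : HasTypeITimeDecay C v)
    (hcont : ContinuousOn (uncurry v) (Iio (0 : ℝ) ×ˢ univ))
    (hmild : ∀ s t : ℝ, s < t → t < 0 → ∀ x,
      v t x = UnboundedOperators.heatExtension (v s) (t - s) x - oseenDuhamel 1 s v v t x)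
    (hdiv : ∀ t < 0, VectorCalculus.IsDivFree (v t)) {t : ℝ} (ht : t < 0) :
    ContDiff ℝ ∞ fun x => deriv (fun s => v s x) t := by
  have hA : IsTypeIAncientMild C v := isTypeIAncientMild_of_class hrate hcont hmild hdiv
  have hsm : IsSmoothSpaceTimeOn (Iio (0 : ℝ)) v := hA.contDiffOn
  exact (hsm.isSmoothSpaceTimeOn_deriv isOpen_Iio).contDiff_slice ht

/-- **`∂ₜv(t,·)` is divergence-free** (differentiate `div v(s,·)(x) = 0` in `s`; `∂ₜ` and `D` commute for the jointly
smooth class, Literature `IsSmoothSpaceTimeOn.hasDerivAt_fderiv_slice_clm`). -/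
theorem div_timeDeriv_slice (hrate : HasTypeITimeDecay C v)
    (hcont : ContinuousOn (uncurry v) (Iio (0 : ℝ) ×ˢ univ))
    (hmild : ∀ s t : ℝ, s < t → t < 0 → ∀ x,
      v t x = UnboundedOperators.heatExtension (v s) (t - s) x - oseenDuhamel 1 s v v t x)
    (hdiv : ∀ t < 0, VectorCalculus.IsDivFree (v t)) {t : ℝ} (ht : t < 0) (x : EuclideanSpace ℝ (Fin 3)) :
    fderiv ℝ (fun y => deriv (fun s => v s y) t) x (EuclideanSpace.single 0 (1 : ℝ)) 0 +
      fderiv ℝ (fun y => deriv (fun s => v s y) t) x (EuclideanSpace.single 1 (1 : ℝ)) 1 +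
      fderiv ℝ (fun y => deriv (fun s => v s y) t) x (EuclideanSpace.single 2 (1 : ℝ)) 2 = 0 := by
  have hA : IsTypeIAncientMild C v := isTypeIAncientMild_of_class hrate hcont hmild hdiv
  have hsm : IsSmoothSpaceTimeOn (Iio (0 : ℝ)) v := hA.contDiffOn
  -- `s ↦ D(v s)(x)` has derivative `D(∂ₜv(t,·))(x)` at `t`
  have hD := hsm.hasDerivAt_fderiv_slice_clm isOpen_Iio ht x
  -- the divergence in coordinates as a continuous linear functional of `D(v s)(x)`
  set L : (EuclideanSpace ℝ (Fin 3) →L[ℝ] EuclideanSpace ℝ (Fin 3)) →L[ℝ] ℝ :=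
    (EuclideanSpace.proj (𝕜 := ℝ) (0 : Fin 3)).comp
        (ContinuousLinearMap.apply ℝ (EuclideanSpace ℝ (Fin 3)) (EuclideanSpace.single 0 (1 : ℝ))) +
      (EuclideanSpace.proj (𝕜 := ℝ) (1 : Fin 3)).comp
        (ContinuousLinearMap.apply ℝ (EuclideanSpace ℝ (Fin 3)) (EuclideanSpace.single 1 (1 : ℝ))) +
      (EuclideanSpace.proj (𝕜 := ℝ) (2 : Fin 3)).comp
        (ContinuousLinearMap.apply ℝ (EuclideanSpace ℝ (Fin 3)) (EuclideanSpace.single 2 (1 : ℝ))) with hL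
  have hLapply : ∀ D : EuclideanSpace ℝ (Fin 3) →L[ℝ] EuclideanSpace ℝ (Fin 3),
      L D = D (EuclideanSpace.single 0 (1 : ℝ)) 0 + D (EuclideanSpace.single 1 (1 : ℝ)) 1 +
        D (EuclideanSpace.single 2 (1 : ℝ)) 2 := fun D => by
    simp [hL]
  have hcomp : HasDerivAt (fun s => L (fderiv ℝ (v s) x)) (L (fderiv ℝ (fun y => deriv (fun s => v s y) t) x)) t :=
    (L.hasFDerivAt.comp_hasDerivAt t hD)
  -- the composed function vanishes near `t`
  have hzero : (fun s => L (fderiv ℝ (v s) x)) =ᶠ[𝓝 t] fun _ => (0 : ℝ) := by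
    filter_upwards [Iio_mem_nhds ht] with s hs
    rw [hLapply]
    exact div_coord (hdiv s hs) x
  have h0 : L (fderiv ℝ (fun y => deriv (fun s => v s y) t) x) = 0 := by
    have h1 := hcomp.deriv
    rw [hzero.deriv_eq, deriv_const] at h1
    exact h1.symm
  rw [hLapply] at h0
  exact h0

end Summit.NavierStokesRegularity.NavierStokesRegularity.Theorems.PoloidalWindowDoorPoloidalWindowRigidityConstantShearSlice

end
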